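import Literature.MathematicalPhysics.QuantumFieldTheory.Balaban1983to89.T3AlphaPolymerSocket
import Summits.QuantumFields.YangMills.Theorems.UnitScaleTiltFluctuationComparisonRegPrSocketLevelsAlpha
import HarnessLib

/-!
# Route `UnitScaleTilt` — crux K1bR-pr `FluctuationComparisonRegPr` (stmt-QuantumFields-19201), stub 3b `stub_cauchyOfLocalRep`: the LEVEL socket
# `LevelCauchyAt (levelData D)` FROM THE POLYMER SOCKET `PolymerCauchyAt D` under matched localisation domains
# (support file `--supports stmt-QuantumFields-19201`; the stub stays open)

Fleet lead `ym-ust-19201-p2` (gen 0); MEMO-19201-SE-anatomy v3 «ladder of record», last bookkeeping rung: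
`stub 3 ⇐(p452026) 3a + 3b`, `3b: CauchyAtHeights D ⇐(p456396) LevelCauchyAt (levelData D) ⇐(THIS FILE) PolymerCauchyAt D + LocMatched D`.
**`levelCauchyAt_of_polymerwise`**: the matched step sums of `levelData` are sums over localisation domains in bijection under `refineSet`
(`LocMatched`, `Finset.sum_nbij`), so the per-polymer inequalities of `PolymerCauchyAt` (finitely many per step: `Filter.eventually_all_finset`) add up
(`Finset.abs_sum_le_sum_abs`) to the per-step budgets `δ K j := Σ_{Y ∈ Loc} η K j Y`, constants `c K j := Σ_Y c K j Y`; the extra finest slice passes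
through at level granularity.  consumes: `LocMatched` (mapsTo/injOn/surjOn of the bijection), every clause of `PolymerCauchyAt`.  Below this rung sits the
analysis (e1–e3 of the memo: minimiser two-cut-off closeness, propagators, activity Lipschitz/analyticity [Balaban1987RG1] (1.11)–(1.18)).
WHAT THIS IS NOT: no estimate is asserted.

References: C. King, CMP 102 (1986) 649–677 [King1986] (Thm 3.4 (3.9) p.656; Props 3.8–3.9 pp.664–665); T. Bałaban, CMP 102 (1985) 255–275
[Balaban1985UV3] ((24) p.262, (43) p.266).
-/

noncomputable section

open MeasureTheory Filter Topology
open Literature.MathematicalPhysics.QuantumFieldTheory.Balaban1983to89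
open Literature.MathematicalPhysics.QuantumFieldTheory.Balaban1983to89.T3ContinuumYM3Torus
open Literature.MathematicalPhysics.QuantumFieldTheory.Balaban1983to89.T3LevelShift
open Literature.MathematicalPhysics.QuantumFieldTheory.Balaban1983to89.T3UnitLawDensityEML (ℰp measurableE_ℰp)
open Literature.MathematicalPhysics.QuantumFieldTheory.Balaban1983to89.T3UnitScaleTilt
open Literature.MathematicalPhysics.QuantumFieldTheory.Balaban1983to89.T3TiltDescent
open Literature.MathematicalPhysics.QuantumFieldTheory.Balaban1983to89.T3LogComparisonSocket
open Literature.MathematicalPhysics.QuantumFieldTheory.Balaban1983to89.T3AlphaInputsAC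
open Literature.MathematicalPhysics.QuantumFieldTheory.Balaban1983to89.T3AlphaPolymerSocket
open Literature.MathematicalPhysics.QuantumFieldTheory.Balaban1983to89.Missing
open Summit.QuantumFields.YangMills.Theorems.LogComparisonSocketLevelsAlpha (levelData)

namespace Summit.QuantumFields.YangMills.Theorems.LogComparisonSocketPolymers

variable {F : T3Family} {γ : ℝ} (D : AlphaDataT3 F γ)

/-- **`LevelCauchyAt (levelData D)` FROM `PolymerCauchyAt D` UNDER MATCHED LOCALISATION DOMAINS** ([King1986] §3.4's term-by-term replacement, summed
per renormalisation step): per-step budgets `δ K j := Σ_{Y ∈ Loc K (K−⌊K/m⌋) triv (1+j)} η K j Y`, constants `c K j := Σ_Y c K j Y`.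
[cite: King1986, Prop. 3.8-3.9 pp.664-665] -/
theorem levelCauchyAt_of_polymerwise (b₀ p₀ : ℝ) (m : ℕ) (hmatch : LocMatched D) (h : PolymerCauchyAt D b₀ p₀ m) :
    LevelCauchyAt F γ b₀ p₀ m (levelData D) := by
  obtain ⟨η, c, δ₀, c₀, hη, hδ₀, hS, hextra, hmatched⟩ := h
  refine ⟨fun K j => ∑ Y ∈ D.Loc K (K - K / m) (D.triv K (K - K / m)) (1 + j), η K j Y,
    fun K j => ∑ Y ∈ D.Loc K (K - K / m) (D.triv K (K - K / m)) (1 + j), c K j Y, δ₀, c₀,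
    fun K j => Finset.sum_nonneg fun Y _ => hη K j Y, hδ₀, hS, fun K => ?_, fun K j hj => ?_⟩
  · -- the extra finest slice: `levelData D (K+1) 0 (K/m)` is the sum of the level-1 terms of run `K+1`
    filter_upwards [hextra K] with V hV hs h0 h0'
    have hle : K / m ≤ K + 1 := (Nat.div_le_self K m).trans (Nat.le_succ K)
    have hld : levelData D (K + 1) 0 (K / m) V =
        ∑ Y ∈ D.Loc (K + 1) (K + 1 - K / m) (D.triv (K + 1) (K + 1 - K / m)) 1,
          D.Pterm (K + 1) 1 Y (D.Umin (K + 1) (K + 1 - K / m) (D.triv (K + 1) (K + 1 - K / m))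
            (fieldShift (F.sitesPerDir_eq (m := F.m) (K := K + 1) (j := K + 1 - K / m) (m' := F.m) (K' := K / m) (j' := 0) (by omega)) V)) := by
      simp only [levelData, dif_pos hle]
    rw [hld]
    exact hV hs h0 h0'
  · -- the matched step `j`: rewrite run `K+1`'s sum over refined domains, then add the per-polymer inequalities
    have hdl : K / m ≤ K := Nat.div_le_self K m
    have hle : K / m ≤ K + 1 := hdl.trans (Nat.le_succ K)
    set LocK := D.Loc K (K - K / m) (D.triv K (K - K / m)) (1 + j) with hLocK
    have hall : ∀ᵐ V ∂fieldMeasure (F.P (K / m)) 0 (Matrix.specialUnitaryGroup (Fin 2) ℂ), ∀ Y ∈ LocK,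
        PlaqSmall (θBal F.L γ b₀ p₀ (K / m)) V →
          0 < heightDensity F γ (Nat.div_le_self K m) (histGood F ℰp (θBal F.L γ b₀ p₀) K (K / m)) V →
          0 < heightDensity F γ ((Nat.div_le_self K m).trans (Nat.le_succ K))
                (histGood F ℰp (θBal F.L γ b₀ p₀) (K + 1) (K / m)) V →
            |D.Pterm (K + 1) (1 + (j + 1)) (refineSet F K Y) (D.Umin (K + 1) (K + 1 - K / m) (D.triv (K + 1) (K + 1 - K / m))
                (fieldShift (F.sitesPerDir_eq (m := F.m) (K := K + 1) (j := K + 1 - K / m) (m' := F.m) (K' := K / m) (j' := 0) (by omega)) V)) -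
              D.Pterm K (1 + j) Y (D.Umin K (K - K / m) (D.triv K (K - K / m))
                (fieldShift (F.sitesPerDir_eq (m := F.m) (K := K) (j := K - K / m) (m' := F.m) (K' := K / m) (j' := 0) (by omega)) V)) -
              c K j Y| ≤ η K j Y :=
      (Filter.eventually_all_finset LocK).mpr fun Y hY => hmatched K j hj Y hY
    filter_upwards [hall] with V hV hs h0 h0'
    -- the bijection of localisation domains at level `1 + j` ↔ `1 + j + 1`
    have hbij := hmatch K (K / m) hdl (1 + j) (by omega) (by omega)
    -- unfold both `levelData`
    have hldK : levelData D K j (K / m) V = ∑ Y ∈ LocK, D.Pterm K (1 + j) Y (D.Umin K (K - K / m) (D.triv K (K - K / m))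
        (fieldShift (F.sitesPerDir_eq (m := F.m) (K := K) (j := K - K / m) (m' := F.m) (K' := K / m) (j' := 0) (by omega)) V)) := by
      simp only [levelData, dif_pos hdl, hLocK]
    have hldK1 : levelData D (K + 1) (j + 1) (K / m) V =
        ∑ Y' ∈ D.Loc (K + 1) (K + 1 - K / m) (D.triv (K + 1) (K + 1 - K / m)) (1 + (j + 1)),
          D.Pterm (K + 1) (1 + (j + 1)) Y' (D.Umin (K + 1) (K + 1 - K / m) (D.triv (K + 1) (K + 1 - K / m))
            (fieldShift (F.sitesPerDir_eq (m := F.m) (K := K + 1) (j := K + 1 - K / m) (m' := F.m) (K' := K / m) (j' := 0) (by omega)) V)) := by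
      simp only [levelData, dif_pos hle]
    -- run `K+1`'s sum over matched domains = sum over run `K`'s domains of the refined terms
    have hsum : ∑ Y' ∈ D.Loc (K + 1) (K + 1 - K / m) (D.triv (K + 1) (K + 1 - K / m)) (1 + (j + 1)),
          D.Pterm (K + 1) (1 + (j + 1)) Y' (D.Umin (K + 1) (K + 1 - K / m) (D.triv (K + 1) (K + 1 - K / m))
            (fieldShift (F.sitesPerDir_eq (m := F.m) (K := K + 1) (j := K + 1 - K / m) (m' := F.m) (K' := K / m) (j' := 0) (by omega)) V)) =
        ∑ Y ∈ LocK, D.Pterm (K + 1) (1 + (j + 1)) (refineSet F K Y) (D.Umin (K + 1) (K + 1 - K / m) (D.triv (K + 1) (K + 1 - K / m))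
            (fieldShift (F.sitesPerDir_eq (m := F.m) (K := K + 1) (j := K + 1 - K / m) (m' := F.m) (K' := K / m) (j' := 0) (by omega)) V)) := by
      symm
      exact Finset.sum_nbij (refineSet F K) (fun Y hY => hbij.mapsTo hY) (fun Y₁ h₁ Y₂ h₂ h12 => hbij.injOn h₁ h₂ h12)
        (fun Y' hY' => hbij.surjOn hY') (fun Y _ => rfl)
    rw [hldK, hldK1, hsum, ← Finset.sum_sub_distrib, ← Finset.sum_sub_distrib]
    exact (Finset.abs_sum_le_sum_abs _ _).trans (Finset.sum_le_sum fun Y hY => hV Y hY hs h0 h0')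

end Summit.QuantumFields.YangMills.Theorems.LogComparisonSocketPolymers

end
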